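import Summits.BirchSwinnertonDyer.BirchSwinnertonDyer.Theorems.ThetaPartnerAtTwoMazurTateCongruenceAtTwoRSymbolMuPointwise
import Summits.BirchSwinnertonDyer.BirchSwinnertonDyer.Theorems.ThetaPartnerAtTwoSignedMainConjectureCMTwoRankZeroFlatOfCuspSpan
import Summits.BirchSwinnertonDyer.BirchSwinnertonDyer.Theorems.ThetaPartnerAtTwoSignedMainConjectureCMTwoRankZeroOfLowerUpToTwoPower
import HarnessLib

/-!
# Crux `MazurTateCongruenceAtTwoTop` (stmt-BirchSwinnertonDyer-25797 = `MazurTateCongruenceAtTwoR` 21416), line `symbol`: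
# the FLAT road — the symbol-`μ` statement `Hμ` and THE CRUX BY NAME from «analytic `μ♭ = 0` at `2`» (Pollack's conjecture
# `μ(L⁻_2) = 0` for weight-`2` newforms with `a₂ = 0`, read for the curves of the theta habitat and their CM partners)
# (width seat bsd-wall-tp2-p1-w2 g2; `--supports stmt-BirchSwinnertonDyer-25797`; closes nothing)

HONEST FRAMING. THEOREMS ONLY. The named Literature facts and the statement FLAT («for every Pollack pair `(L⁺, L⁻)` of the
newform at `2`, Kobayashi's `L♭ = kobayashiL 1 L⁺ L⁻ (= L⁻)` has a unit coefficient», i.e. `μ(L♭_f) = 0` — Pollack 2003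
Conj. 6.3 / Perrin-Riou at the supersingular prime `2`, OPEN in print class-wide) are explicit HYPOTHESES; nothing about their
truth is asserted; BSD is not proved by any of this.

WHY THIS ROAD. Route ThetaPartnerAtTwo's own K2 column already carries the `μ`-input in FLAT currency (item 26470
`AnalyticMuFlatCMTwoRankZero`: the registered text `∃ n, IsUnit (PowerSeries.coeff n (kobayashiL 1 Lplus Lminus))` for rank-`0` CM
partners off the unit zone; tp2-p2-w3's FLAT census 762/762). This file states K1's research residue in the SAME currency: the crux
binds a Pollack pair for `W` and for `A`, so FLAT can be asked of exactly those pairs.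

WHAT.
* §1 `undepletedMax_of_not_two_dvd_flat` /
  `undepletedMax_of_exists_isUnit_coeff_kobayashiL` — FLAT at `(E, f, L⁺, L⁻)` ⟹ (PR₂) at `(E, f)` («the undepleted `2`-adic plus
  symbol is maximal over `ℚ` at an even-layer `2`-power cusp»): rtt-p4-w3's `SignedMuAtTwo.not_two_dvd_flat_iff_exists_norm_ratPlusSymbol_eq_two`
  (`2 ∤ L⁻` ⟺ some even-layer `[γ^s/2^{n+2}]⁺_f` has norm `2`) + the universal bound `norm_ratPlusSymbol_le_two` (rtt-p3-w3 g4).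
  (The converse (PR₂) ⟹ FLAT is rtt-p3-w3 g4's `flatAtTwo_of_undepletedMax`; so on GoodSS-`2`/`a₂ = 0` curves with a Pollack pair,
  FLAT ⟺ (PR₂): `not_two_dvd_flat_iff_undepletedMax`.)
* §2 `symbolMu_of_flat` — `Hμ(E)` from `realPeriodRat_eq_unit_mul_plusPeriod_two` + FLAT at one Pollack pair of `E`'s newform.
* §3 `mazurTateCongruence_of_facts_flat` — the CONCLUSION OF THE CRUX at one pair `(W, A)` from PUB⁶ + the period fact + FLAT at the
  two Pollack pairs the crux itself binds (`u = 1`).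
* §4 `mazurTateCongruenceAtTwoTop_of_facts_flat` — THE CRUX BY NAME behind PUB⁶ + the period fact + «FLAT for every globally minimal
  curve good supersingular at `2` with `a₂ = 0`, every newform, every Pollack pair at `2`» (`…_abbesUllmo_flat`: the period fact from
  Abbes–Ullmo; `…R_of_facts_flat`: the twin 21416).

NET (with `…RSymbolMuOfCuspSpan`, `…RSymbolMuPointwise`): K1's one research input may be taken in any of the three currencies
CuspSpanEvenAtTwo (curve-free, per level) ⟹ (PR₂) (per curve, symbol-level) ⟺ FLAT (per curve and Pollack pair, `Λ`-level), each
for `W` and for the CM partner `A`; everything else is the seven named Literature facts.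

References: [Pollack2003] Conj. 6.3, Prop. 6.18; [PollackWeston2011MT] §3.1, Rem. 4.2.1; [GreenbergVatsal2000] Thm. (1.4), §3 (13),
Remark 3.4; [Vatsal1999] Thm. (1.13); [Kobayashi2003] (3.6); [AbbesUllmo1996] Thm. A.
-/

-- justification: the `Summit.BirchSwinnertonDyer.BirchSwinnertonDyer.…` path repeats a component (route-file convention)
set_option linter.dupNamespace false
set_option autoImplicit false

noncomputable section

open scoped Classical MatrixGroups ModularForm

open CongruenceSubgroup Polynomial WeierstrassCurve NumberField IsDedekindDomain
  Literature.NumberTheory.IwasawaTheory Literature.NumberTheory.EllipticCurves Literature.NumberTheory.EllipticCurves.ModularForms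
  Literature.NumberTheory.EllipticCurves.Rank1Residual Literature.NumberTheory.EllipticCurves.GreenbergVatsal2000
  Summit.BirchSwinnertonDyer.Rank1Residual.Supersingular
  Summit.BirchSwinnertonDyer.BirchSwinnertonDyer.Theorems.ThetaLayerLambdaCongruenceAtTwo

namespace Summit.BirchSwinnertonDyer.BirchSwinnertonDyer.Theorems.MazurTateCongruenceAtTwoR

/-! ## §1. FLAT ⟹ (PR₂) at one curve -/

section Flat

variable (E : WeierstrassCurve ℚ) [E.IsElliptic] [E.IsGloballyMinimal]

/-- **FLAT ⟹ (PR₂).** For a globally minimal elliptic `E` good supersingular at `2` with `a₂(E) = 0`, its newform `f` and a Pollack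
pair `(L⁺, L⁻)` of `f` at `2` with `2 ∤ L⁻`: the undepleted `2`-adic plus symbol `[·]⁺_f` is maximal over `ℚ` at a `2`-power cusp
`γ^s/2^{n+2}` of some EVEN layer `n`. (`2 ∤ L⁻` ⟺ some even-layer value has norm `2`, rtt-p4-w3's
`SignedMuAtTwo.not_two_dvd_flat_iff_exists_norm_ratPlusSymbol_eq_two`; every value has norm `≤ 2`, `norm_ratPlusSymbol_le_two`.)
[cite: Pollack2003, Prop. 6.18] [cite: PollackWeston2011MT, §3.1 and Rem. 4.2.1] -/
theorem undepletedMax_of_not_two_dvd_flat (hss : GoodSS E 2) (ha : E.frobeniusTrace 2 = 0) [NeZero (E.conductorNorm ℤ)]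
    {f : CuspForm (Gamma0 (E.conductorNorm ℤ)) 2} (hf : IsNewformOf E f) {Lplus Lminus : IwasawaAlgebra 2}
    (hP : IsPollackPair f 2 Lplus Lminus) (hflat : ¬ PowerSeries.C (2 : ℤ_[2]) ∣ Lminus) :
    ∃ n₁ : ℕ, Even n₁ ∧ ∃ s : ZMod (2 ^ n₁), ∀ r : ℚ, ‖algebraMap ℚ (PadicAlgCl 2) (ratPlusSymbol f r)‖ ≤
      ‖algebraMap ℚ (PadicAlgCl 2) (ratPlusSymbol f ((((cyclotomicGenerator 2 : ZMod (2 ^ (n₁ + 2))) ^ s.val).val : ℚ) / (2 : ℚ) ^ (n₁ + 2)))‖ := by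
  obtain ⟨n, hn, s, hs⟩ := (SignedMuAtTwo.not_two_dvd_flat_iff_exists_norm_ratPlusSymbol_eq_two f hP).mp hflat
  refine ⟨n, hn, s, fun r ↦ ?_⟩
  rw [norm_algebraMap_rat_eq_norm_ratCast_padic (ratPlusSymbol f ((((cyclotomicGenerator 2 : ZMod (2 ^ (n + 2))) ^ s.val).val : ℚ) / (2 : ℚ) ^ (n + 2))), hs]
  exact norm_ratPlusSymbol_le_two hf hss ha r

/-- **FLAT in route ThetaPartnerAtTwo's K2 currency ⟹ (PR₂)**: if Kobayashi's `L♭ = kobayashiL 1 L⁺ L⁻` has a unit coefficient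
(the shape of item 26470 `AnalyticMuFlatCMTwoRankZero`), then (PR₂) holds at `(E, f)`. [cite: Pollack2003, Conj. 6.3 and Prop. 6.18]
[cite: Kobayashi2003, (3.6)] -/
theorem undepletedMax_of_exists_isUnit_coeff_kobayashiL (hss : GoodSS E 2) (ha : E.frobeniusTrace 2 = 0)
    [NeZero (E.conductorNorm ℤ)] {f : CuspForm (Gamma0 (E.conductorNorm ℤ)) 2} (hf : IsNewformOf E f)
    {Lplus Lminus : IwasawaAlgebra 2} (hP : IsPollackPair f 2 Lplus Lminus)
    (hflat : ∃ n : ℕ, IsUnit (PowerSeries.coeff n (kobayashiL 1 Lplus Lminus))) :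
    ∃ n₁ : ℕ, Even n₁ ∧ ∃ s : ZMod (2 ^ n₁), ∀ r : ℚ, ‖algebraMap ℚ (PadicAlgCl 2) (ratPlusSymbol f r)‖ ≤
      ‖algebraMap ℚ (PadicAlgCl 2) (ratPlusSymbol f ((((cyclotomicGenerator 2 : ZMod (2 ^ (n₁ + 2))) ^ s.val).val : ℚ) / (2 : ℚ) ^ (n₁ + 2)))‖ := by
  rw [kobayashiL_one] at hflat
  exact undepletedMax_of_not_two_dvd_flat E hss ha hf hP (not_C_two_dvd_of_exists_isUnit_coeff hflat)

/-- **FLAT ⟺ (PR₂)** on a globally minimal curve good supersingular at `2` with `a₂ = 0`, for any Pollack pair of its newform at `2`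
(⟸ is rtt-p3-w3 g4's `flatAtTwo_of_undepletedMax`: the maximum is at least the Manin-cusp value `1/2` of norm `2`).
[cite: Pollack2003, Prop. 6.18] [cite: PollackWeston2011MT, Rem. 4.2.1] -/
theorem not_two_dvd_flat_iff_undepletedMax (hss : GoodSS E 2) (ha : E.frobeniusTrace 2 = 0) [NeZero (E.conductorNorm ℤ)]
    {f : CuspForm (Gamma0 (E.conductorNorm ℤ)) 2} (hf : IsNewformOf E f) {Lplus Lminus : IwasawaAlgebra 2}
    (hP : IsPollackPair f 2 Lplus Lminus) :
    ¬ PowerSeries.C (2 : ℤ_[2]) ∣ Lminus ↔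
      ∃ n₁ : ℕ, Even n₁ ∧ ∃ s : ZMod (2 ^ n₁), ∀ r : ℚ, ‖algebraMap ℚ (PadicAlgCl 2) (ratPlusSymbol f r)‖ ≤
        ‖algebraMap ℚ (PadicAlgCl 2) (ratPlusSymbol f ((((cyclotomicGenerator 2 : ZMod (2 ^ (n₁ + 2))) ^ s.val).val : ℚ) / (2 : ℚ) ^ (n₁ + 2)))‖ :=
  ⟨undepletedMax_of_not_two_dvd_flat E hss ha hf hP, fun h ↦ flatAtTwo_of_undepletedMax hf h Lplus Lminus hP⟩

end Flat

/-! ## §2. `Hμ(E)` from FLAT and the period fact -/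

section SymbolMu

variable (E : WeierstrassCurve ℚ) [E.IsElliptic] [E.IsGloballyMinimal]

/-- **`Hμ(E)` from FLAT.** For a globally minimal elliptic `E` good supersingular at `2` with `a₂(E) = 0`, its newform `f`, `ϖ` with
`ϖ·Ω_E = Ω⁺_f`, `S₀` off `2`, and a Pollack pair `(L⁺, L⁻)` of `f` at `2` whose `L♭ = kobayashiL 1 L⁺ L⁻` has a unit coefficient:
granted `realPeriodRat_eq_unit_mul_plusPeriod_two`, the expanded `S₀`-depleted plus table is maximal over `ℚ` at some `x₀` with
`‖2ϖΨ^{S₀}_E(x₀)‖ = 1` (FLAT ⟹ (PR₂) §1, then `symbolMu_of_undepletedMax`). [cite: Pollack2003, Conj. 6.3 and Prop. 6.18]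
[cite: GreenbergVatsal2000, §3, Remark 3.4] -/
theorem symbolMu_of_flat (h2 : realPeriodRat_eq_unit_mul_plusPeriod_two) (hss : GoodSS E 2)
    (ha : E.frobeniusTrace 2 = 0) [NeZero (E.conductorNorm ℤ)] {f : CuspForm (Gamma0 (E.conductorNorm ℤ)) 2} (hf : IsNewformOf E f)
    {ϖ : ℚ} (hϖ : (ϖ : ℝ) * E.realPeriodRat = plusPeriod f) {Lplus Lminus : IwasawaAlgebra 2} (hP : IsPollackPair f 2 Lplus Lminus)
    (hflat : ∃ n : ℕ, IsUnit (PowerSeries.coeff n (kobayashiL 1 Lplus Lminus)))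
    (S₀ : Finset (HeightOneSpectrum (𝓞 ℚ))) (hS2 : ∀ v ∈ S₀, ((2 : ℕ) : 𝓞 ℚ) ∉ v.asIdeal) :
    ∃ x₀ : ℚ, (∀ r : ℚ, ‖(∑ k ∈ Fintype.piFinset (fun _ : S₀ ↦ Finset.range 3), (∏ v : S₀, ((E.localPolynomialAt (v : HeightOneSpectrum (𝓞 ℚ))).map (Int.castRingHom (PadicAlgCl 2))).coeff (k v) * ((Rat.HeightOneSpectrum.natGenerator (v : HeightOneSpectrum (𝓞 ℚ)) : PadicAlgCl 2)⁻¹) ^ (k v)) * algebraMap ℚ (PadicAlgCl 2) (ratPlusSymbol f (r * ((∏ v : S₀, Rat.HeightOneSpectrum.natGenerator (v : HeightOneSpectrum (𝓞 ℚ)) ^ (k v) : ℕ) : ℚ))))‖ ≤ ‖(∑ k ∈ Fintype.piFinset (fun _ : S₀ ↦ Finset.range 3), (∏ v : S₀, ((E.localPolynomialAt (v : HeightOneSpectrum (𝓞 ℚ))).map (Int.castRingHom (PadicAlgCl 2))).coeff (k v) * ((Rat.HeightOneSpectrum.natGenerator (v : HeightOneSpectrum (𝓞 ℚ)) : PadicAlgCl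 2)⁻¹) ^ (k v)) * algebraMap ℚ (PadicAlgCl 2) (ratPlusSymbol f (x₀ * ((∏ v : S₀, Rat.HeightOneSpectrum.natGenerator (v : HeightOneSpectrum (𝓞 ℚ)) ^ (k v) : ℕ) : ℚ))))‖) ∧
      ‖algebraMap ℚ (PadicAlgCl 2) (2 * ϖ) * (∑ k ∈ Fintype.piFinset (fun _ : S₀ ↦ Finset.range 3), (∏ v : S₀, ((E.localPolynomialAt (v : HeightOneSpectrum (𝓞 ℚ))).map (Int.castRingHom (PadicAlgCl 2))).coeff (k v) * ((Rat.HeightOneSpectrum.natGenerator (v : HeightOneSpectrum (𝓞 ℚ)) : PadicAlgCl 2)⁻¹) ^ (k v)) * algebraMap ℚ (PadicAlgCl 2) (ratPlusSymbol f (x₀ * ((∏ v : S₀, Rat.HeightOneSpectrum.natGenerator (v : HeightOneSpectrum (𝓞 ℚ)) ^ (k v) : ℕ) : ℚ))))‖ = 1 :=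
  symbolMu_of_undepletedMax E h2 hss ha hf hϖ S₀ hS2 (undepletedMax_of_exists_isUnit_coeff_kobayashiL E hss ha hf hP hflat)

end SymbolMu

/-! ## §3. The conclusion of the crux at one pair `(W, A)` from FLAT at the two Pollack pairs -/

section Pair

variable (W : WeierstrassCurve ℚ) [W.IsElliptic] [W.IsGloballyMinimal] (A : WeierstrassCurve ℚ) [A.IsElliptic]
  [A.IsGloballyMinimal]

/-- **The crux's conclusion at `(W, A)` from PUB⁶ + the period fact + FLAT at the crux's own two Pollack pairs.** For `W, A` globally
minimal, good supersingular at `2` with `a₂ = 0`, `Δ_W < 0`, a Galois-equivariant `W[2] ≃+ A[2]`, newforms `f, f_A`, Néron ratios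
`ϖ, ϖ_A`, Pollack pairs `(L⁺, L⁻)`, `(L⁺_A, L⁻_A)` at `2` whose flat members `kobayashiL 1 · ·` each have a unit coefficient
(`μ(L♭_f) = μ(L♭_{f_A}) = 0`), an admissible `S₀` and integral multiples `G, G_A`: the oriented `S₀`-depleted Mazur–Tate congruence holds at
every even layer with `u = 1`. [cite: GreenbergVatsal2000, Thm. (1.4), §3 (13)] [cite: Vatsal1999, Thm. (1.13)] [cite: Pollack2003, Conj. 6.3] -/
theorem mazurTateCongruence_of_facts_flat
    (hES : eichlerShimura_depletedOptimalQuotient_periodLattice_of_dvd)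
    (hF : WeierstrassCurve.isIsogenous_iff_frobeniusTrace_eq) (hMK : mazurKenku_exists_cyclic_isogeny)
    (hSD : heckeSelfDual_torsionBy_J0) (hBz : buzzard2000_multiplicityOne_gamma0)
    (hSe : serre1972_supersingular_decompositionSubgroup_image)
    (h2 : realPeriodRat_eq_unit_mul_plusPeriod_two)
    (hss : GoodSS W 2) (ha : W.frobeniusTrace 2 = 0) (hΔ : W.Δ < 0) (hssA : GoodSS A 2) (haA : A.frobeniusTrace 2 = 0)
    (he : ∃ e : geomTorsion W (2 : ℤ) ≃+ geomTorsion A (2 : ℤ),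
      ∀ (σ : Field.absoluteGaloisGroup ℚ) (P : geomTorsion W (2 : ℤ)), e (σ • P) = σ • e P)
    [NeZero (W.conductorNorm ℤ)] (f : CuspForm (Gamma0 (W.conductorNorm ℤ)) 2) (hf : IsNewformOf W f) {ϖ : ℚ}
    (hϖ : (ϖ : ℝ) * W.realPeriodRat = plusPeriod f)
    {Lplus Lminus : IwasawaAlgebra 2} (hPP : IsPollackPair f 2 Lplus Lminus)
    (hflatW : ∃ n : ℕ, IsUnit (PowerSeries.coeff n (kobayashiL 1 Lplus Lminus)))
    [NeZero (A.conductorNorm ℤ)] (fA : CuspForm (Gamma0 (A.conductorNorm ℤ)) 2) (hfA : IsNewformOf A fA) {ϖA : ℚ}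
    (hϖA : (ϖA : ℝ) * A.realPeriodRat = plusPeriod fA)
    {LplusA LminusA : IwasawaAlgebra 2} (hPPA : IsPollackPair fA 2 LplusA LminusA)
    (hflatA : ∃ n : ℕ, IsUnit (PowerSeries.coeff n (kobayashiL 1 LplusA LminusA)))
    (S₀ : Finset (HeightOneSpectrum (𝓞 ℚ))) (hS2 : ∀ v ∈ S₀, ((2 : ℕ) : 𝓞 ℚ) ∉ v.asIdeal)
    (hSW : ∀ v : HeightOneSpectrum (𝓞 ℚ), ¬ W.HasGoodReductionAt v → v ∈ S₀)
    (hSA : ∀ v : HeightOneSpectrum (𝓞 ℚ), ¬ A.HasGoodReductionAt v → v ∈ S₀)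
    {G GA : IwasawaAlgebra 2} {m m' : ℕ}
    (hG : iwasawaToPowerSeries 2 G =
      PowerSeries.C ((2 : ℚ_[2]) ^ m * (ϖ : ℚ_[2])) * iwasawaToPowerSeries 2 (kobayashiL 1 Lplus Lminus))
    (hGA : iwasawaToPowerSeries 2 GA =
      PowerSeries.C ((2 : ℚ_[2]) ^ m' * (ϖA : ℚ_[2])) * iwasawaToPowerSeries 2 (kobayashiL 1 LplusA LminusA)) :
    ∃ u : ℤ_[2]ˣ, ∀ n : ℕ, Even n → ∃ q r : IwasawaAlgebra 2,
      PowerSeries.C (((2 : ℤ_[2]) ^ m' : ℤ_[2]) : ℚ_[2]) *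
            (PowerSeries.C ((2 : ℚ_[2]) ^ m * (ϖ : ℚ_[2])) *
              ((mazurTateElement f 2 n).map (algebraMap ℚ ℚ_[2]) : PowerSeries ℚ_[2]) *
              iwasawaToPowerSeries 2 (eulerFactorProductInv W 2 S₀)) -
          PowerSeries.C (((u : ℤ_[2]) * (2 : ℤ_[2]) ^ m : ℤ_[2]) : ℚ_[2]) *
            (PowerSeries.C ((2 : ℚ_[2]) ^ m' * (ϖA : ℚ_[2])) *
              ((mazurTateElement fA 2 n).map (algebraMap ℚ ℚ_[2]) : PowerSeries ℚ_[2]) *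
              iwasawaToPowerSeries 2 (eulerFactorProductInv A 2 S₀)) =
        iwasawaToPowerSeries 2 (PowerSeries.C ((2 : ℤ_[2]) ^ (m + m' + 1)) * q + Sprung2017.toIwasawa 2 (cyclotomicOmega 2 n) * r) :=
  mazurTateCongruence_of_facts W A hES hF hMK hSD hBz hSe hss hΔ hssA he f hf ϖ hPP fA hfA ϖA hPPA S₀ hS2 hSW hSA
    (symbolMu_of_flat W h2 hss ha hf hϖ hPP hflatW S₀ hS2) (symbolMu_of_flat A h2 hssA haA hfA hϖA hPPA hflatA S₀ hS2) hG hGA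

end Pair

/-! ## §4. THE CRUX BY NAME behind the seven named facts and «analytic `μ♭ = 0` at `2`» -/

section Crux

/-- **`MazurTateCongruenceAtTwoTop` (crux 25797 = 21416) BY NAME behind PUB⁶ + the period fact + FLAT.** Granted the six named facts
of the plus line, `realPeriodRat_eq_unit_mul_plusPeriod_two`, and «analytic `μ♭ = 0` at `2`»: for every globally minimal elliptic `E`
good supersingular at `2` with `a₂(E) = 0`, its newform `f` and every Pollack pair `(L⁺, L⁻)` of `f` at `2`, Kobayashi's
`L♭ = kobayashiL 1 L⁺ L⁻` has a unit coefficient (Pollack 2003 Conj. 6.3 at `p = 2` for these forms — OPEN in print; the shape of route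
ThetaPartnerAtTwo's item 26470 without the CM / rank / unit-zone restrictions), the crux holds. Proof: the crux's own binders supply
the Pollack pairs; `HΔ` by `habitatNegDisc`; `Hμ` at `W` and at `A` by `symbolMu_of_flat`; the lead's one-socket assembly
`mazurTateCongruence_of_facts`. BSD is not proved by this. [cite: Pollack2003, Conj. 6.3] [cite: GreenbergVatsal2000, Thm. (1.4), §3 (13)]
[cite: Vatsal1999, Thm. (1.13)] -/
theorem mazurTateCongruenceAtTwoTop_of_facts_flat
    (hES : eichlerShimura_depletedOptimalQuotient_periodLattice_of_dvd)
    (hF : WeierstrassCurve.isIsogenous_iff_frobeniusTrace_eq) (hMK : mazurKenku_exists_cyclic_isogeny)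
    (hSD : heckeSelfDual_torsionBy_J0) (hBz : buzzard2000_multiplicityOne_gamma0)
    (hSe : serre1972_supersingular_decompositionSubgroup_image)
    (h2 : realPeriodRat_eq_unit_mul_plusPeriod_two)
    (hFlat : ∀ (E : WeierstrassCurve ℚ) [E.IsElliptic] [E.IsGloballyMinimal], GoodSS E 2 → E.frobeniusTrace 2 = 0 →
      ∀ [NeZero (E.conductorNorm ℤ)] (f : CuspForm (Gamma0 (E.conductorNorm ℤ)) 2), IsNewformOf E f →
      ∀ (Lplus Lminus : IwasawaAlgebra 2), IsPollackPair f 2 Lplus Lminus →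
      ∃ n : ℕ, IsUnit (PowerSeries.coeff n (kobayashiL 1 Lplus Lminus))) :
    Summit.BirchSwinnertonDyer.BirchSwinnertonDyer.Theses.ThetaPartnerAtTwo.MazurTateCongruenceAtTwoTop := by
  intro W _ _ A _ _ _ _ hss ha hAcm hAss hAa he γ _ _ f hf ϖ hϖ Lplus Lminus hPP _ fA hfA ϖA hϖA LplusA LminusA hPPA
    S₀ hS2 hSW hSA G m hG GA m' hGA
  have hΔ : W.Δ < 0 := by
    obtain ⟨e, he'⟩ := he
    exact ThetaPartnerXRoute.Δ_neg_of_cmPartner_two W A hAcm hAss e he'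
  exact mazurTateCongruence_of_facts_flat W A hES hF hMK hSD hBz hSe h2 hss ha hΔ hAss hAa he f hf hϖ hPP
    (hFlat W hss ha f hf Lplus Lminus hPP) fA hfA hϖA hPPA (hFlat A hAss hAa fA hfA LplusA LminusA hPPA) S₀ hS2 hSW hSA hG hGA

/-- The same with the period fact DERIVED from Abbes–Ullmo Thm. A (`SkinnerUrban2014.realPeriodRat_eq_unit_mul_plusPeriod_two_fact_of_abbesUllmo`):
the crux BY NAME behind {Eichler–Shimura (depleted optimal quotient), Faltings, Mazur–Kenku, Hecke self-duality, Buzzard, Serre 1972,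
Abbes–Ullmo} + «analytic `μ♭ = 0` at `2` for every GoodSS-`2`/`a₂ = 0` curve». BSD is not proved by this.
[cite: AbbesUllmo1996, Thm. A] [cite: Pollack2003, Conj. 6.3] [cite: GreenbergVatsal2000, Thm. (1.4), §3 (13)] -/
theorem mazurTateCongruenceAtTwoTop_of_facts_abbesUllmo_flat
    (hES : eichlerShimura_depletedOptimalQuotient_periodLattice_of_dvd)
    (hF : WeierstrassCurve.isIsogenous_iff_frobeniusTrace_eq) (hMK : mazurKenku_exists_cyclic_isogeny)
    (hSD : heckeSelfDual_torsionBy_J0) (hBz : buzzard2000_multiplicityOne_gamma0)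
    (hSe : serre1972_supersingular_decompositionSubgroup_image)
    (hAU : abbesUllmo_not_dvd_maninConstant_of_not_dvd_level)
    (hFlat : ∀ (E : WeierstrassCurve ℚ) [E.IsElliptic] [E.IsGloballyMinimal], GoodSS E 2 → E.frobeniusTrace 2 = 0 →
      ∀ [NeZero (E.conductorNorm ℤ)] (f : CuspForm (Gamma0 (E.conductorNorm ℤ)) 2), IsNewformOf E f →
      ∀ (Lplus Lminus : IwasawaAlgebra 2), IsPollackPair f 2 Lplus Lminus →
      ∃ n : ℕ, IsUnit (PowerSeries.coeff n (kobayashiL 1 Lplus Lminus))) :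
    Summit.BirchSwinnertonDyer.BirchSwinnertonDyer.Theses.ThetaPartnerAtTwo.MazurTateCongruenceAtTwoTop :=
  mazurTateCongruenceAtTwoTop_of_facts_flat hES hF hMK hSD hBz hSe
    (SkinnerUrban2014.realPeriodRat_eq_unit_mul_plusPeriod_two_fact_of_abbesUllmo hAU) hFlat

/-- The twin `MazurTateCongruenceAtTwoR` (stmt-21416) BY NAME behind PUB⁶ + the period fact + FLAT. BSD is not proved by this.
[cite: Pollack2003, Conj. 6.3] [cite: GreenbergVatsal2000, Thm. (1.4), §3 (13)] -/
theorem mazurTateCongruenceAtTwoR_of_facts_flat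
    (hES : eichlerShimura_depletedOptimalQuotient_periodLattice_of_dvd)
    (hF : WeierstrassCurve.isIsogenous_iff_frobeniusTrace_eq) (hMK : mazurKenku_exists_cyclic_isogeny)
    (hSD : heckeSelfDual_torsionBy_J0) (hBz : buzzard2000_multiplicityOne_gamma0)
    (hSe : serre1972_supersingular_decompositionSubgroup_image)
    (h2 : realPeriodRat_eq_unit_mul_plusPeriod_two)
    (hFlat : ∀ (E : WeierstrassCurve ℚ) [E.IsElliptic] [E.IsGloballyMinimal], GoodSS E 2 → E.frobeniusTrace 2 = 0 →
      ∀ [NeZero (E.conductorNorm ℤ)] (f : CuspForm (Gamma0 (E.conductorNorm ℤ)) 2), IsNewformOf E f →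
      ∀ (Lplus Lminus : IwasawaAlgebra 2), IsPollackPair f 2 Lplus Lminus →
      ∃ n : ℕ, IsUnit (PowerSeries.coeff n (kobayashiL 1 Lplus Lminus))) :
    Summit.BirchSwinnertonDyer.BirchSwinnertonDyer.Theses.ThetaPartnerAtTwo.MazurTateCongruenceAtTwoR :=
  mazurTateCongruenceAtTwoTop_of_facts_flat hES hF hMK hSD hBz hSe h2 hFlat

end Crux

end Summit.BirchSwinnertonDyer.BirchSwinnertonDyer.Theorems.MazurTateCongruenceAtTwoR

end
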